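import Summits.QuantumFields.BalabanUV.Beta.FP.TowerDoorDefectLoc
import Summits.QuantumFields.BalabanUV.Beta.FP.RepAlgebraTsum
import Summits.QuantumFields.BalabanUV.Beta.FP.RepAlgebraBubble
import Literature.MathematicalPhysics.QuantumFieldTheory.Balaban1983to89.Beta.KernelReflection

/-!
# `BalabanUV.Beta.FP.TowerDoorDefectPieces` — binder row D1, the row's ONE file, the `ω`-EXHIBITION, part 1 (J-NOTE-21 §7 (B)): **THE THREE PIECES OF THE WARD-DEFECT KERNEL PASS
# THROUGH THE TADPOLE AS `ℓ¹` PAIRINGS OF THE GAUGE FUNCTION** — the gradient piece `Σ'_u (v(u+e_κ) − v u)·M2Z (u,κ) β` (ff-masked) gives `Σ'_u (v(u+e_κ) − v u)·tadpole A (M2Z-piece u)`, the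
# multiplication-operator pieces `E_v·H_β` and `H_β·E_v` give `Σ'_u v u·tadpole A (row-cut u)` and `Σ'_u v u·tadpole A (column-cut u)`: three instances of PART 63 `tadpole_tsumKer` with the
# stencils RESCALED by `e^{+ρ|u − L•β.1|₁}` so that their bi-localisation constant is uniform and the weights inherit the decay (bounded `v` ⇒ `ℓ¹` weights)
# (β-function cell `pub-balaban`, BINDER-OWNERS row D1 ∕ (C1) OWNER «beta-an2» gen 77, PART 66; imports PART 64 + PART 63 + lit `KernelReflection`; part 2 = the assembly `tadpole A (defKerZ v β) = Σ'_u ω_β(u)·v u`)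

WHAT ([folklore] `BiLoc`∕`tsum` bookkeeping BY NAME; no `def`, no `def … : Prop`, nothing cited, 0 sorry, default heartbeats; the pieces are LAMBDAS — no new definition).
§1 `defKerZ_apply_pieces` (PART 62's `defKerZ` read as: gradient pieces (ff-masked `M2Z`) minus `κ₂`× (row piece − column piece), pointwise on every leg), `biLoc_ffMask` (masking to the ff legs keeps a bi-localisation).
§2 **`tadpole_gradPiece`** (`Decays A CA (δ/2)`, (Lmix) at rate `δ`, `|v| ≤ V`): `tadpole A (x w a b ↦ Σ'_u (v(u+e_κ) − v u)·[M2Z (u,κ) β]_ff x w a b) = Σ'_u (v(u+e_κ) − v u)·tadpole A ([M2Z (u,κ) β]_ff)`.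
§3 **`tadpole_rowPiece`** ∕ **`tadpole_colPiece`** (`Decays A CA (δ/2)`, (LH) `VertexFamily tabs.H L C_H δ`, `|v| ≤ V`): `tadpole A (x w a b ↦ v x·[H_β]_ff x w a b) = Σ'_u v u·tadpole A (row-cut u)` and the column twin,
`row-cut u := x w a b ↦ [u = x]·[H_β]_ff x w a b` (bi-localised at `(u,u)` with constant `C_H·e^{−(δ/2)|u−L•β.1|₁}` at rate `δ/2` — `biLoc_rowCut`∕`biLoc_colCut`).
WHAT THIS IS NOT: not yet the assembled `ω_β` nor its covariance (part 2); nothing of Bałaban's asserted, valued or discharged; 0 estimates; 0∕4 row-D1 binders (hW, hR, D1Tel, D1Rep); NOT (C1), NOT D1, NEVER «G-an2-4 closed»,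
NOT BetaPertH, NOT continuum, NOT Clay.

HONEST DEPENDENCY (page 1, mandatory): continuum YM on T⁴ ⇐ BetaPertH ∧ nine spine estimates (0/9 proved); BetaPertH ⇐ (D1) ∧ (D4) ∧ CAP+tail;
G-an2-4 gates asym, D1 and NE2/3/4.  HONEST FRAMING (cell contract, verbatim): «discharging `BetaPertH` makes Bałaban's UV stability UNCONDITIONAL —
a real constructive-QFT result; it is NOT the continuum limit and NOT the Clay problem.»  ABSOLUTE RULE (cell charter, verbatim): «No internally-minted
statement may enter as a cited fact. Every hypothesis is either kernel-proved in this package or a verbatim quotation of a PUBLISHED theorem with page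
reference. The manuscript(s) under audit are NOT citable for their own disputed steps — they are the thing under adjudication; programme-internal
(2001/route/tribunal) claims are never citable.»  Row D1 ∕ (C1) OWNER «beta-an2» gen 77, 2026-08-29.  No existing file touched.
-/

noncomputable section

open Finset
open scoped BigOperators
open Literature.MathematicalPhysics.QuantumFieldTheory
open Literature.MathematicalPhysics.QuantumFieldTheory.Balaban1983to89
open Literature.MathematicalPhysics.QuantumFieldTheory.Balaban1983to89.Beta
open Literature.MathematicalPhysics.QuantumFieldTheory.Balaban1983to89.B12Sec2to5 (l1 l1_nonneg)
open AffineAveraging (Site unitVec)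
open OneStepResolventKernel (Fib)
open ExpKernelCalculus (MKer BiLoc Decays VertexFamily Zl Zl_nonneg tadpole l1_sub_triangle l1_sub_symm summable_exp_shift summable_exp_shift')
open SecondOrderResponse (LocStencilFM)
open KernelReflection (tadpole_smul)
open BalabanStepW2 (wM2)
open Summit.QuantumFields.BalabanUV.Beta.SymmetrisedStepJets (SymTables)
open Summit.QuantumFields.BalabanUV.Beta.FP.RepAlgebraTrace (abs_le_of_biLoc)
open Summit.QuantumFields.BalabanUV.Beta.FP.RepAlgebraBubble (biLoc_of_rate_le)
open Summit.QuantumFields.BalabanUV.Beta.FP.RepAlgebraTsum (tadpole_tsumKer summable_mul_tadpole)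
open Summit.QuantumFields.BalabanUV.Beta.FP.TowerDoorDefectDefs
open Summit.QuantumFields.BalabanUV.Beta.FP.TowerDoorDefectLoc (biLoc_M2Z)

namespace Summit.QuantumFields.BalabanUV.Beta.FP.TowerDoorDefectPieces

variable (L : ℕ) (tabs : SymTables 3 L) (κ₂ : ℝ)

/-! ## §1 The defect kernel as gradient pieces minus `κ₂`× (row piece − column piece); masking keeps bi-localisation -/

/-- [folklore] **`defKerZ_apply_pieces`** — on every leg: `defKerZ … v β x w a b = (Σ_κ Σ'_u (v(u+e_κ) − v u)·[M2Z (u,κ) β]_ff x w a b) − κ₂·(v x·[H_β]_ff x w a b − [H_β]_ff x w a b·v w)`,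
`[K]_ff` the kernel `K` masked to the field legs. -/
theorem defKerZ_apply_pieces (v : Site (3 + 1) → ℝ) (β : Site (3 + 1) × Fin (3 + 1)) (x w : Site (3 + 1)) (a b : Fib 3) :
    defKerZ L tabs κ₂ v β x w a b
      = (∑ κ : Fin (3 + 1), ∑' u : Site (3 + 1), (v (u + unitVec κ) - v u)
          * Sum.elim (fun α : Fin (3 + 1) => Sum.elim (fun α' : Fin (3 + 1) => M2Z L tabs (u, κ) β x w (Sum.inl α) (Sum.inl α')) (fun _ => (0 : ℝ)) b) (fun _ => (0 : ℝ)) a)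
        - κ₂ * (v x * Sum.elim (fun α : Fin (3 + 1) => Sum.elim (fun α' : Fin (3 + 1) => tabs.H β.2 β.1 x w (Sum.inl α) (Sum.inl α')) (fun _ => (0 : ℝ)) b) (fun _ => (0 : ℝ)) a
          - Sum.elim (fun α : Fin (3 + 1) => Sum.elim (fun α' : Fin (3 + 1) => tabs.H β.2 β.1 x w (Sum.inl α) (Sum.inl α')) (fun _ => (0 : ℝ)) b) (fun _ => (0 : ℝ)) a * v w) := by
  rcases a with α | m
  · rcases b with α' | m'
    · rw [defKerZ_apply_inl_inl]; rfl
    · rw [defKerZ_inr_right]; simp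
  · rw [defKerZ_inr_left]; simp

/-- [folklore] masking a kernel to the field legs keeps a bi-localisation. -/
theorem biLoc_ffMask {K : MKer (3 + 1) (Fib 3)} {p q : Site (3 + 1)} {C δ : ℝ} (h : BiLoc K p q C δ) :
    BiLoc (fun (x w : Site (3 + 1)) (a b : Fib 3) => Sum.elim (fun α : Fin (3 + 1) => Sum.elim (fun α' : Fin (3 + 1) => K x w (Sum.inl α) (Sum.inl α')) (fun _ => (0 : ℝ)) b) (fun _ => (0 : ℝ)) a)
      p q C δ := by
  intro x w a b
  have hC : 0 ≤ C := h.nonneg (Sum.inl 0)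
  rcases a with α | m
  · rcases b with α' | m'
    · exact h x w (Sum.inl α) (Sum.inl α')
    · simp only [Sum.elim_inl, Sum.elim_inr, abs_zero]; positivity
  · simp only [Sum.elim_inr, abs_zero]; positivity

/-! ## §2 The gradient piece through the tadpole -/

/-- [folklore] **`tadpole_gradPiece`** — for `Decays A CA (δ/2)`, (Lmix) `LocStencilFM L tabs.mixFF C δ` (`δ > 0`) and `|v| ≤ V`:
`tadpole A (x w a b ↦ Σ'_u (v(u+e_κ) − v u)·[M2Z (u,κ) β]_ff x w a b) = Σ'_u (v(u+e_κ) − v u)·tadpole A ([M2Z (u,κ) β]_ff)` (PART 63 with the stencils rescaled by `e^{+δ|u−L•β.1|₁}`, PART 64 `biLoc_M2Z`). -/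
theorem tadpole_gradPiece {A : MKer (3 + 1) (Fib 3)} {CA C δ : ℝ} (hδ : 0 < δ) (hA : Decays A CA (δ / 2)) (hmix : LocStencilFM L tabs.mixFF C δ)
    {v : Site (3 + 1) → ℝ} {V : ℝ} (hv : ∀ u, |v u| ≤ V) (κ : Fin (3 + 1)) (β : Site (3 + 1) × Fin (3 + 1)) :
    tadpole A (fun (x w : Site (3 + 1)) (a b : Fib 3) => ∑' u : Site (3 + 1), (v (u + unitVec κ) - v u)
        * Sum.elim (fun α : Fin (3 + 1) => Sum.elim (fun α' : Fin (3 + 1) => M2Z L tabs (u, κ) β x w (Sum.inl α) (Sum.inl α')) (fun _ => (0 : ℝ)) b) (fun _ => (0 : ℝ)) a)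
      = ∑' u : Site (3 + 1), (v (u + unitVec κ) - v u)
          * tadpole A (fun (x w : Site (3 + 1)) (a b : Fib 3) => Sum.elim (fun α : Fin (3 + 1) => Sum.elim (fun α' : Fin (3 + 1) => M2Z L tabs (u, κ) β x w (Sum.inl α) (Sum.inl α')) (fun _ => (0 : ℝ)) b) (fun _ => (0 : ℝ)) a) := by
  have hδ2 : 0 < δ / 2 := half_pos hδ
  set p₀ : Site (3 + 1) := ((L : ℕ) : ℤ) • β.1 with hp₀
  -- the masked stencil at `u`, rescaled so that its constant is uniform
  let M : Site (3 + 1) → MKer (3 + 1) (Fib 3) := fun (u : Site (3 + 1)) (x w : Site (3 + 1)) (a b : Fib 3) =>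
    Sum.elim (fun α : Fin (3 + 1) => Sum.elim (fun α' : Fin (3 + 1) => M2Z L tabs (u, κ) β x w (Sum.inl α) (Sum.inl α')) (fun _ => (0 : ℝ)) b) (fun _ => (0 : ℝ)) a
  let T : Site (3 + 1) → MKer (3 + 1) (Fib 3) := fun u => Real.exp (δ * l1 (u - p₀)) • M u
  let c : Site (3 + 1) → ℝ := fun u => (v (u + unitVec κ) - v u) * Real.exp (-δ * l1 (u - p₀))
  have hM : ∀ u, BiLoc (M u) u u (|wM2 3 L 0| * (C * Real.exp (-δ * l1 (u - p₀)))) δ := fun u => biLoc_ffMask (biLoc_M2Z L tabs hmix u κ β)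
  have hC : 0 ≤ C := hmix.nonneg
  have hT : ∀ u, BiLoc (T u) u u (|wM2 3 L 0| * C) (δ / 2) := by
    intro u
    refine biLoc_of_rate_le (fun x z a b => ?_) (by linarith : δ / 2 ≤ δ)
    have h := hM u x z a b
    show |(Real.exp (δ * l1 (u - p₀)) • M u) x z a b| ≤ _
    rw [Pi.smul_apply, Pi.smul_apply, Pi.smul_apply, Pi.smul_apply, smul_eq_mul, abs_mul, abs_of_pos (Real.exp_pos _)]
    have e : Real.exp (δ * l1 (u - p₀)) * Real.exp (-δ * l1 (u - p₀)) = 1 := by rw [← Real.exp_add]; simp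
    calc Real.exp (δ * l1 (u - p₀)) * |M u x z a b|
        ≤ Real.exp (δ * l1 (u - p₀)) * (|wM2 3 L 0| * (C * Real.exp (-δ * l1 (u - p₀))) * Real.exp (-δ * (l1 (x - u) + l1 (z - u)))) :=
          mul_le_mul_of_nonneg_left h (Real.exp_pos _).le
      _ = (Real.exp (δ * l1 (u - p₀)) * Real.exp (-δ * l1 (u - p₀))) * (|wM2 3 L 0| * C * Real.exp (-δ * (l1 (x - u) + l1 (z - u)))) := by ring
      _ = |wM2 3 L 0| * C * Real.exp (-δ * (l1 (x - u) + l1 (z - u))) := by rw [e, one_mul]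
  have hc : Summable (fun u => |c u|) := by
    refine Summable.of_nonneg_of_le (fun u => abs_nonneg _) (fun u => ?_) ((summable_exp_shift' hδ p₀).mul_left (2 * V))
    show |(v (u + unitVec κ) - v u) * Real.exp (-δ * l1 (u - p₀))| ≤ 2 * V * Real.exp (-δ * l1 (u - p₀))
    rw [abs_mul, abs_of_pos (Real.exp_pos _)]
    refine mul_le_mul_of_nonneg_right ?_ (Real.exp_pos _).le
    calc |v (u + unitVec κ) - v u| ≤ |v (u + unitVec κ)| + |v u| := abs_sub _ _
      _ ≤ V + V := add_le_add (hv _) (hv _)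
      _ = 2 * V := by ring
  have key := tadpole_tsumKer (ι := Site (3 + 1)) hA hδ2 (by positivity : 0 ≤ |wM2 3 L 0| * C) hT hc
  -- the kernel IS that superposition (the exponentials cancel pointwise)
  have e1 : ∀ u, c u * Real.exp (δ * l1 (u - p₀)) = v (u + unitVec κ) - v u := by
    intro u
    show (v (u + unitVec κ) - v u) * Real.exp (-δ * l1 (u - p₀)) * Real.exp (δ * l1 (u - p₀)) = _
    rw [mul_assoc, ← Real.exp_add]; simp
  have hker : (fun (x w : Site (3 + 1)) (a b : Fib 3) => ∑' u : Site (3 + 1), (v (u + unitVec κ) - v u) * M u x w a b) = fun (x w : Site (3 + 1)) (a b : Fib 3) => ∑' u, c u * T u x w a b := by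
    funext x w a b
    refine tsum_congr fun u => ?_
    show _ = c u * ((Real.exp (δ * l1 (u - p₀)) • M u) x w a b)
    rw [Pi.smul_apply, Pi.smul_apply, Pi.smul_apply, Pi.smul_apply, smul_eq_mul, ← mul_assoc, e1]
  have e2 : ∀ u, c u * tadpole A (T u) = (v (u + unitVec κ) - v u) * tadpole A (M u) := by
    intro u
    show c u * tadpole A (Real.exp (δ * l1 (u - p₀)) • M u) = _
    rw [tadpole_smul, ← mul_assoc, e1]
  show tadpole A (fun (x w : Site (3 + 1)) (a b : Fib 3) => ∑' u : Site (3 + 1), (v (u + unitVec κ) - v u) * M u x w a b) = ∑' u, (v (u + unitVec κ) - v u) * tadpole A (M u)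
  rw [hker, key]
  exact tsum_congr e2

/-! ## §3 The multiplication-operator pieces through the tadpole -/

/-- [folklore] **`biLoc_rowCut`** — under (LH) at rate `δ`, the row-cut `x w a b ↦ [u = x]·[H_β]_ff x w a b` is bi-localised at `(u, u)` with constant `C_H·e^{−(δ/2)|u − L•β.1|₁}` at rate `δ/2`
(`|w − u|₁ ≤ |w − L•β.1|₁ + |u − L•β.1|₁`). -/
theorem biLoc_rowCut {C_H δ : ℝ} (hδ : 0 ≤ δ) (hH : VertexFamily tabs.H L C_H δ) (β : Site (3 + 1) × Fin (3 + 1)) (u : Site (3 + 1)) :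
    BiLoc (fun (x w : Site (3 + 1)) (a b : Fib 3) => if u = x then
        Sum.elim (fun α : Fin (3 + 1) => Sum.elim (fun α' : Fin (3 + 1) => tabs.H β.2 β.1 x w (Sum.inl α) (Sum.inl α')) (fun _ => (0 : ℝ)) b) (fun _ => (0 : ℝ)) a else 0)
      u u (C_H * Real.exp (-(δ / 2) * l1 (u - ((L : ℕ) : ℤ) • β.1))) (δ / 2) := by
  have hCH : 0 ≤ C_H := (hH β.2 β.1).nonneg (Sum.inl 0)
  intro x w a b
  dsimp only
  by_cases hux : u = x
  · subst hux
    rw [if_pos rfl]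
    have h := biLoc_ffMask (hH β.2 β.1) u w a b
    refine h.trans ?_
    rw [sub_self, show l1 (0 : Site (3 + 1)) = 0 by simp [l1], zero_add, mul_assoc, ← Real.exp_add]
    refine mul_le_mul_of_nonneg_left (Real.exp_le_exp.mpr ?_) hCH
    have t := l1_sub_triangle w (((L : ℕ) : ℤ) • β.1) u
    rw [l1_sub_symm (((L : ℕ) : ℤ) • β.1) u] at t
    nlinarith [l1_nonneg (u - ((L : ℕ) : ℤ) • β.1), l1_nonneg (w - ((L : ℕ) : ℤ) • β.1), l1_nonneg (w - u)]
  · rw [if_neg hux, abs_zero]; positivity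

/-- [folklore] **`biLoc_colCut`** — the column twin: `x w a b ↦ [u = w]·[H_β]_ff x w a b` is bi-localised at `(u, u)` with the same constant and rate. -/
theorem biLoc_colCut {C_H δ : ℝ} (hδ : 0 ≤ δ) (hH : VertexFamily tabs.H L C_H δ) (β : Site (3 + 1) × Fin (3 + 1)) (u : Site (3 + 1)) :
    BiLoc (fun (x w : Site (3 + 1)) (a b : Fib 3) => if u = w then
        Sum.elim (fun α : Fin (3 + 1) => Sum.elim (fun α' : Fin (3 + 1) => tabs.H β.2 β.1 x w (Sum.inl α) (Sum.inl α')) (fun _ => (0 : ℝ)) b) (fun _ => (0 : ℝ)) a else 0)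
      u u (C_H * Real.exp (-(δ / 2) * l1 (u - ((L : ℕ) : ℤ) • β.1))) (δ / 2) := by
  have hCH : 0 ≤ C_H := (hH β.2 β.1).nonneg (Sum.inl 0)
  intro x w a b
  dsimp only
  by_cases huw : u = w
  · subst huw
    rw [if_pos rfl]
    have h := biLoc_ffMask (hH β.2 β.1) x u a b
    refine h.trans ?_
    rw [sub_self, show l1 (0 : Site (3 + 1)) = 0 by simp [l1], add_zero, mul_assoc, ← Real.exp_add]
    refine mul_le_mul_of_nonneg_left (Real.exp_le_exp.mpr ?_) hCH
    have t := l1_sub_triangle x (((L : ℕ) : ℤ) • β.1) u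
    rw [l1_sub_symm (((L : ℕ) : ℤ) • β.1) u] at t
    nlinarith [l1_nonneg (u - ((L : ℕ) : ℤ) • β.1), l1_nonneg (x - ((L : ℕ) : ℤ) • β.1), l1_nonneg (x - u)]
  · rw [if_neg huw, abs_zero]; positivity

/-- [folklore] **`tadpole_rowPiece`** — for `Decays A CA (δ/2)`, (LH) at rate `δ > 0` and `|v| ≤ V`: `tadpole A (x w a b ↦ v x·[H_β]_ff x w a b) = Σ'_u v u·tadpole A (row-cut u)` (PART 63 with the
row-cuts rescaled by `e^{+(δ/2)|u−L•β.1|₁}`; the superposition has one nonzero term per entry, `tsum_eq_single`). -/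
theorem tadpole_rowPiece {A : MKer (3 + 1) (Fib 3)} {CA C_H δ : ℝ} (hδ : 0 < δ) (hA : Decays A CA (δ / 2)) (hH : VertexFamily tabs.H L C_H δ)
    {v : Site (3 + 1) → ℝ} {V : ℝ} (hv : ∀ u, |v u| ≤ V) (β : Site (3 + 1) × Fin (3 + 1)) :
    tadpole A (fun (x w : Site (3 + 1)) (a b : Fib 3) => v x * Sum.elim (fun α : Fin (3 + 1) => Sum.elim (fun α' : Fin (3 + 1) => tabs.H β.2 β.1 x w (Sum.inl α) (Sum.inl α')) (fun _ => (0 : ℝ)) b) (fun _ => (0 : ℝ)) a)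
      = ∑' u : Site (3 + 1), v u * tadpole A (fun (x w : Site (3 + 1)) (a b : Fib 3) => if u = x then
          Sum.elim (fun α : Fin (3 + 1) => Sum.elim (fun α' : Fin (3 + 1) => tabs.H β.2 β.1 x w (Sum.inl α) (Sum.inl α')) (fun _ => (0 : ℝ)) b) (fun _ => (0 : ℝ)) a else 0) := by
  have hδ2 : 0 < δ / 2 := half_pos hδ
  have hCH : 0 ≤ C_H := (hH β.2 β.1).nonneg (Sum.inl 0)
  set p₀ : Site (3 + 1) := ((L : ℕ) : ℤ) • β.1 with hp₀
  let Hm : MKer (3 + 1) (Fib 3) := fun (x w : Site (3 + 1)) (a b : Fib 3) =>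
    Sum.elim (fun α : Fin (3 + 1) => Sum.elim (fun α' : Fin (3 + 1) => tabs.H β.2 β.1 x w (Sum.inl α) (Sum.inl α')) (fun _ => (0 : ℝ)) b) (fun _ => (0 : ℝ)) a
  let R : Site (3 + 1) → MKer (3 + 1) (Fib 3) := fun (u : Site (3 + 1)) (x w : Site (3 + 1)) (a b : Fib 3) => if u = x then Hm x w a b else 0
  let T : Site (3 + 1) → MKer (3 + 1) (Fib 3) := fun u => Real.exp ((δ / 2) * l1 (u - p₀)) • R u
  let c : Site (3 + 1) → ℝ := fun u => v u * Real.exp (-(δ / 2) * l1 (u - p₀))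
  have hR : ∀ u, BiLoc (R u) u u (C_H * Real.exp (-(δ / 2) * l1 (u - p₀))) (δ / 2) := fun u => biLoc_rowCut L tabs hδ.le hH β u
  have hT : ∀ u, BiLoc (T u) u u C_H (δ / 2) := by
    intro u x z a b
    have h := hR u x z a b
    show |(Real.exp ((δ / 2) * l1 (u - p₀)) • R u) x z a b| ≤ _
    rw [Pi.smul_apply, Pi.smul_apply, Pi.smul_apply, Pi.smul_apply, smul_eq_mul, abs_mul, abs_of_pos (Real.exp_pos _)]
    have e : Real.exp ((δ / 2) * l1 (u - p₀)) * Real.exp (-(δ / 2) * l1 (u - p₀)) = 1 := by rw [← Real.exp_add]; simp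
    calc Real.exp ((δ / 2) * l1 (u - p₀)) * |R u x z a b|
        ≤ Real.exp ((δ / 2) * l1 (u - p₀)) * (C_H * Real.exp (-(δ / 2) * l1 (u - p₀)) * Real.exp (-(δ / 2) * (l1 (x - u) + l1 (z - u)))) :=
          mul_le_mul_of_nonneg_left h (Real.exp_pos _).le
      _ = (Real.exp ((δ / 2) * l1 (u - p₀)) * Real.exp (-(δ / 2) * l1 (u - p₀))) * (C_H * Real.exp (-(δ / 2) * (l1 (x - u) + l1 (z - u)))) := by ring
      _ = C_H * Real.exp (-(δ / 2) * (l1 (x - u) + l1 (z - u))) := by rw [e, one_mul]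
  have hc : Summable (fun u => |c u|) := by
    refine Summable.of_nonneg_of_le (fun u => abs_nonneg _) (fun u => ?_) ((summable_exp_shift' hδ2 p₀).mul_left V)
    show |v u * Real.exp (-(δ / 2) * l1 (u - p₀))| ≤ V * Real.exp (-(δ / 2) * l1 (u - p₀))
    rw [abs_mul, abs_of_pos (Real.exp_pos _)]
    exact mul_le_mul_of_nonneg_right (hv u) (Real.exp_pos _).le
  have key := tadpole_tsumKer (ι := Site (3 + 1)) hA hδ2 hCH hT hc
  have e1 : ∀ u, c u * Real.exp ((δ / 2) * l1 (u - p₀)) = v u := by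
    intro u
    show v u * Real.exp (-(δ / 2) * l1 (u - p₀)) * Real.exp ((δ / 2) * l1 (u - p₀)) = _
    rw [mul_assoc, ← Real.exp_add]; simp
  -- the kernel IS that superposition: one nonzero term per entry
  have hker : (fun (x w : Site (3 + 1)) (a b : Fib 3) => v x * Hm x w a b) = fun (x w : Site (3 + 1)) (a b : Fib 3) => ∑' u, c u * T u x w a b := by
    funext x w a b
    have hsingle : (∑' u, c u * T u x w a b) = c x * T x x w a b := by
      refine tsum_eq_single x fun u hu => ?_
      show c u * ((Real.exp ((δ / 2) * l1 (u - p₀)) • R u) x w a b) = 0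
      rw [Pi.smul_apply, Pi.smul_apply, Pi.smul_apply, Pi.smul_apply, smul_eq_mul]
      show c u * (Real.exp ((δ / 2) * l1 (u - p₀)) * (if u = x then Hm x w a b else 0)) = 0
      rw [if_neg hu, mul_zero, mul_zero]
    rw [hsingle]
    show v x * Hm x w a b = c x * ((Real.exp ((δ / 2) * l1 (x - p₀)) • R x) x w a b)
    rw [Pi.smul_apply, Pi.smul_apply, Pi.smul_apply, Pi.smul_apply, smul_eq_mul, ← mul_assoc, e1]
    show v x * Hm x w a b = v x * (if x = x then Hm x w a b else 0)
    rw [if_pos rfl]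
  have e2 : ∀ u, c u * tadpole A (T u) = v u * tadpole A (R u) := by
    intro u
    show c u * tadpole A (Real.exp ((δ / 2) * l1 (u - p₀)) • R u) = _
    rw [tadpole_smul, ← mul_assoc, e1]
  show tadpole A (fun (x w : Site (3 + 1)) (a b : Fib 3) => v x * Hm x w a b) = ∑' u, v u * tadpole A (R u)
  rw [hker, key]
  exact tsum_congr e2

/-- [folklore] **`tadpole_colPiece`** — the column twin: `tadpole A (x w a b ↦ [H_β]_ff x w a b·v w) = Σ'_u v u·tadpole A (column-cut u)`. -/
theorem tadpole_colPiece {A : MKer (3 + 1) (Fib 3)} {CA C_H δ : ℝ} (hδ : 0 < δ) (hA : Decays A CA (δ / 2)) (hH : VertexFamily tabs.H L C_H δ)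
    {v : Site (3 + 1) → ℝ} {V : ℝ} (hv : ∀ u, |v u| ≤ V) (β : Site (3 + 1) × Fin (3 + 1)) :
    tadpole A (fun (x w : Site (3 + 1)) (a b : Fib 3) => Sum.elim (fun α : Fin (3 + 1) => Sum.elim (fun α' : Fin (3 + 1) => tabs.H β.2 β.1 x w (Sum.inl α) (Sum.inl α')) (fun _ => (0 : ℝ)) b) (fun _ => (0 : ℝ)) a * v w)
      = ∑' u : Site (3 + 1), v u * tadpole A (fun (x w : Site (3 + 1)) (a b : Fib 3) => if u = w then
          Sum.elim (fun α : Fin (3 + 1) => Sum.elim (fun α' : Fin (3 + 1) => tabs.H β.2 β.1 x w (Sum.inl α) (Sum.inl α')) (fun _ => (0 : ℝ)) b) (fun _ => (0 : ℝ)) a else 0) := by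
  have hδ2 : 0 < δ / 2 := half_pos hδ
  have hCH : 0 ≤ C_H := (hH β.2 β.1).nonneg (Sum.inl 0)
  set p₀ : Site (3 + 1) := ((L : ℕ) : ℤ) • β.1 with hp₀
  let Hm : MKer (3 + 1) (Fib 3) := fun (x w : Site (3 + 1)) (a b : Fib 3) =>
    Sum.elim (fun α : Fin (3 + 1) => Sum.elim (fun α' : Fin (3 + 1) => tabs.H β.2 β.1 x w (Sum.inl α) (Sum.inl α')) (fun _ => (0 : ℝ)) b) (fun _ => (0 : ℝ)) a
  let Cc : Site (3 + 1) → MKer (3 + 1) (Fib 3) := fun (u : Site (3 + 1)) (x w : Site (3 + 1)) (a b : Fib 3) => if u = w then Hm x w a b else 0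
  let T : Site (3 + 1) → MKer (3 + 1) (Fib 3) := fun u => Real.exp ((δ / 2) * l1 (u - p₀)) • Cc u
  let c : Site (3 + 1) → ℝ := fun u => v u * Real.exp (-(δ / 2) * l1 (u - p₀))
  have hCc : ∀ u, BiLoc (Cc u) u u (C_H * Real.exp (-(δ / 2) * l1 (u - p₀))) (δ / 2) := fun u => biLoc_colCut L tabs hδ.le hH β u
  have hT : ∀ u, BiLoc (T u) u u C_H (δ / 2) := by
    intro u x z a b
    have h := hCc u x z a b
    show |(Real.exp ((δ / 2) * l1 (u - p₀)) • Cc u) x z a b| ≤ _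
    rw [Pi.smul_apply, Pi.smul_apply, Pi.smul_apply, Pi.smul_apply, smul_eq_mul, abs_mul, abs_of_pos (Real.exp_pos _)]
    have e : Real.exp ((δ / 2) * l1 (u - p₀)) * Real.exp (-(δ / 2) * l1 (u - p₀)) = 1 := by rw [← Real.exp_add]; simp
    calc Real.exp ((δ / 2) * l1 (u - p₀)) * |Cc u x z a b|
        ≤ Real.exp ((δ / 2) * l1 (u - p₀)) * (C_H * Real.exp (-(δ / 2) * l1 (u - p₀)) * Real.exp (-(δ / 2) * (l1 (x - u) + l1 (z - u)))) :=
          mul_le_mul_of_nonneg_left h (Real.exp_pos _).le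
      _ = (Real.exp ((δ / 2) * l1 (u - p₀)) * Real.exp (-(δ / 2) * l1 (u - p₀))) * (C_H * Real.exp (-(δ / 2) * (l1 (x - u) + l1 (z - u)))) := by ring
      _ = C_H * Real.exp (-(δ / 2) * (l1 (x - u) + l1 (z - u))) := by rw [e, one_mul]
  have hc : Summable (fun u => |c u|) := by
    refine Summable.of_nonneg_of_le (fun u => abs_nonneg _) (fun u => ?_) ((summable_exp_shift' hδ2 p₀).mul_left V)
    show |v u * Real.exp (-(δ / 2) * l1 (u - p₀))| ≤ V * Real.exp (-(δ / 2) * l1 (u - p₀))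
    rw [abs_mul, abs_of_pos (Real.exp_pos _)]
    exact mul_le_mul_of_nonneg_right (hv u) (Real.exp_pos _).le
  have key := tadpole_tsumKer (ι := Site (3 + 1)) hA hδ2 hCH hT hc
  have e1 : ∀ u, c u * Real.exp ((δ / 2) * l1 (u - p₀)) = v u := by
    intro u
    show v u * Real.exp (-(δ / 2) * l1 (u - p₀)) * Real.exp ((δ / 2) * l1 (u - p₀)) = _
    rw [mul_assoc, ← Real.exp_add]; simp
  have hker : (fun (x w : Site (3 + 1)) (a b : Fib 3) => Hm x w a b * v w) = fun (x w : Site (3 + 1)) (a b : Fib 3) => ∑' u, c u * T u x w a b := by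
    funext x w a b
    have hsingle : (∑' u, c u * T u x w a b) = c w * T w x w a b := by
      refine tsum_eq_single w fun u hu => ?_
      show c u * ((Real.exp ((δ / 2) * l1 (u - p₀)) • Cc u) x w a b) = 0
      rw [Pi.smul_apply, Pi.smul_apply, Pi.smul_apply, Pi.smul_apply, smul_eq_mul]
      show c u * (Real.exp ((δ / 2) * l1 (u - p₀)) * (if u = w then Hm x w a b else 0)) = 0
      rw [if_neg hu, mul_zero, mul_zero]
    rw [hsingle]
    show Hm x w a b * v w = c w * ((Real.exp ((δ / 2) * l1 (w - p₀)) • Cc w) x w a b)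
    rw [Pi.smul_apply, Pi.smul_apply, Pi.smul_apply, Pi.smul_apply, smul_eq_mul, ← mul_assoc, e1]
    show Hm x w a b * v w = v w * (if w = w then Hm x w a b else 0)
    rw [if_pos rfl, mul_comm]
  have e2 : ∀ u, c u * tadpole A (T u) = v u * tadpole A (Cc u) := by
    intro u
    show c u * tadpole A (Real.exp ((δ / 2) * l1 (u - p₀)) • Cc u) = _
    rw [tadpole_smul, ← mul_assoc, e1]
  show tadpole A (fun (x w : Site (3 + 1)) (a b : Fib 3) => Hm x w a b * v w) = ∑' u, v u * tadpole A (Cc u)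
  rw [hker, key]
  exact tsum_congr e2

end Summit.QuantumFields.BalabanUV.Beta.FP.TowerDoorDefectPieces

end
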